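import Mathlib
import Summits.ValiantsHypothesis.ValiantsHypothesis.Theorems.TriangularDimersDivisionEasy.Negative.Peeling
import Summits.ValiantsHypothesis.ValiantsHypothesis.Theorems.TriangularDimersDivisionEasy.Negative.Rows

/-!
# `TriangularDimersDivisionEasy` — negative-side toolkit 6b: many far-apart mixed gadgets

Crux `stmt-ValiantsHypothesis-5067` (`Theses.DivisionGap.TriangularDimersDivisionEasy`, route
DivisionGap).  Standing disprover (cdisprove gen 1); step V3 of the load-bearing lemma
`false_without_division` (Valiant 1980, Thm 1, for the rhombus; cf. his Lemmas 6–7).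

For a balanced vertex set `A ⊆ R_n` (`n² < 3|A| ≤ 2n²`, `n ≥ 8`) there are validly placed, pairwise
far-apart gadgets whose centre edges are mixed for `A`, at least `(n - 60)/24` of them
(`exists_gadgets`).  Either many inner rows contain a horizontal mixed edge (take those in one residue
class mod 8: transposed gadgets), or few do; then (`exists_full_row` for `A` and for `Aᶜ`) there are an
inner-full and an inner-empty row, and every inner column (one residue class mod 8 of them) carries a
vertical mixed edge between the two (discrete intermediate value theorem: direct gadgets).
[folklore]
-/

namespace Summit.ValiantsHypothesis.ValiantsHypothesis.Theorems.TriangularDimersDivisionEasy.Negative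

open scoped BigOperators

set_option linter.dupNamespace false

noncomputable section

open Classical

variable {n : ℕ}

/-! ## Selection tools -/

/-- Pigeonhole over residues mod `8`. [folklore] -/
theorem exists_mod_class {α : Type*} (S : Finset α) (f : α → ℕ) :
    ∃ r < 8, S.card ≤ 8 * (S.filter fun a => f a % 8 = r).card := by
  have hsum : ∑ r ∈ Finset.range 8, (S.filter fun a => f a % 8 = r).card = S.card := by
    rw [← Finset.card_eq_sum_card_fiberwise (f := fun a => f a % 8) (t := Finset.range 8)]
    intro a _
    exact Finset.mem_range.2 (Nat.mod_lt _ (by norm_num))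
  by_contra h
  push Not at h
  have : ∑ r ∈ Finset.range 8, 8 * (S.filter fun a => f a % 8 = r).card < ∑ _r ∈ Finset.range 8, S.card := by
    apply Finset.sum_lt_sum_of_nonempty (Finset.nonempty_range_iff.2 (by norm_num))
    intro r hr
    exact h r (Finset.mem_range.1 hr)
  rw [← Finset.mul_sum, hsum, Finset.sum_const, Finset.card_range, smul_eq_mul] at this
  exact lt_irrefl _ this

/-- Distinct numbers in one residue class mod `8` are `≥ 8` apart. [folklore] -/
theorem eight_le_abs_sub {a b : ℕ} (hab : a ≠ b) (hmod : a % 8 = b % 8) : (8 : ℤ) ≤ |(a : ℤ) - (b : ℤ)| := by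
  rw [le_abs]
  obtain ⟨k, hk⟩ := Nat.ModEq.dvd hmod.symm
  rcases lt_or_gt_of_ne hab with h | h <;> omega

/-- Discrete intermediate value theorem. [folklore] -/
theorem exists_step (P : ℕ → Prop) {a b : ℕ} (hab : a ≤ b) (ha : P a) (hb : ¬ P b) :
    ∃ k, a ≤ k ∧ k < b ∧ P k ∧ ¬ P (k + 1) := by
  induction b, hab using Nat.le_induction with
  | base => exact absurd ha hb
  | succ m hm ih =>
    by_cases hPm : P m
    · exact ⟨m, hm, Nat.lt_succ_self m, hPm, hb⟩
    · obtain ⟨k, h1, h2, h3, h4⟩ := ih hPm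
      exact ⟨k, h1, Nat.lt_succ_of_lt h2, h3, h4⟩

/-! ## Identifying the centre edge of a placed gadget -/

/-- Ball index `18` is the origin `(0,0)` of the centre edge. [folklore] -/
theorem coord_18 : coord 18 = (0, 0) := by decide
/-- Ball index `25` is the end `(1,0)` of the centre edge. [folklore] -/
theorem coord_25 : coord 25 = (1, 0) := by decide

/-- The placed origin of a gadget centred at `(i, j)` is the vertex `(i, j)`. [folklore] -/
theorem vtx_18_eq (hn : 0 < n) (o : Bool) {i j : ℕ} (hi : i < n) (hj : j < n)
    (hV : Valid n o ((i : ℤ), (j : ℤ))) :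
    vtx hn o ((i : ℤ), (j : ℤ)) 18 = ((⟨i, hi⟩, ⟨j, hj⟩) : Vtx n) := by
  apply zof_injective
  rw [zof_vtx hn o _ hV (by norm_num), coord_18]
  cases o <;> simp [place, zof]

/-- For a transposed gadget centred at `(i, j)` the centre edge ends at `(i, j+1)`. [folklore] -/
theorem vtx_25_eq_true (hn : 0 < n) {i j : ℕ} (hi : i < n) (hj : j + 1 < n)
    (hV : Valid n true ((i : ℤ), (j : ℤ))) :
    vtx hn true ((i : ℤ), (j : ℤ)) 25 = ((⟨i, hi⟩, ⟨j + 1, hj⟩) : Vtx n) := by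
  apply zof_injective
  rw [zof_vtx hn true _ hV (by norm_num), coord_25]
  simp [place, zof]

/-- For a direct gadget centred at `(i, j)` the centre edge ends at `(i+1, j)`. [folklore] -/
theorem vtx_25_eq_false (hn : 0 < n) {i j : ℕ} (hi : i + 1 < n) (hj : j < n)
    (hV : Valid n false ((i : ℤ), (j : ℤ))) :
    vtx hn false ((i : ℤ), (j : ℤ)) 25 = ((⟨i + 1, hi⟩, ⟨j, hj⟩) : Vtx n) := by
  apply zof_injective
  rw [zof_vtx hn false _ hV (by norm_num), coord_25]
  simp [place, zof]

/-! ## The gadgets -/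

section Select

variable (hn : 0 < n) (A : Finset (Vtx n))

/-- Mixedness of the centre edge of `g` for `A`. [folklore] -/
def MixedGad (g : Gad) : Prop :=
  (uOf hn g ∈ A ∧ vOf hn g ∉ A) ∨ (uOf hn g ∉ A ∧ vOf hn g ∈ A)

/-- Case (b): a horizontal mixed edge in an inner row gives a valid mixed (transposed) gadget. [folklore] -/
theorem gadget_of_mixedRow {i : ℕ} (hin : Inner n i) (hmix : MixedRow A i) :
    ∃ j : ℕ, Valid n true ((i : ℤ), (j : ℤ)) ∧ MixedGad hn A (true, ((i : ℤ), (j : ℤ))) := by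
  obtain ⟨j, hj3, hj5, hne⟩ := hmix
  obtain ⟨hi3, hi4⟩ := hin
  have hV : Valid n true ((i : ℤ), (j : ℤ)) := valid_of_bounds_true (by simp; omega) (by simp; omega)
    (by simp; omega) (by simp; omega)
  refine ⟨j, hV, ?_⟩
  have hi : i < n := by omega
  have hj : j < n := by omega
  have hj1 : j + 1 < n := by omega
  unfold MixedGad uOf vOf
  rw [vtx_18_eq hn true hi hj hV, vtx_25_eq_true hn hi hj1 hV]
  rw [memN_iff hi hj, memN_iff hi hj1] at hne
  tauto

/-- Case (c): a vertical mixed edge in an inner column gives a valid mixed (direct) gadget. [folklore] -/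
theorem gadget_of_vertical {k j : ℕ} (hk3 : 3 ≤ k) (hk5 : k + 5 ≤ n) (hj : Inner n j)
    (hne : ¬ (memN A k j ↔ memN A (k + 1) j)) :
    Valid n false ((k : ℤ), (j : ℤ)) ∧ MixedGad hn A (false, ((k : ℤ), (j : ℤ))) := by
  obtain ⟨hj3, hj4⟩ := hj
  have hV : Valid n false ((k : ℤ), (j : ℤ)) := valid_of_bounds_false (by simp; omega) (by simp; omega)
    (by simp; omega) (by simp; omega)
  refine ⟨hV, ?_⟩
  have hk : k < n := by omega
  have hk1 : k + 1 < n := by omega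
  have hjn : j < n := by omega
  unfold MixedGad uOf vOf
  rw [vtx_18_eq hn false hk hjn hV, vtx_25_eq_false hn hk1 hjn hV]
  rw [memN_iff hk hjn, memN_iff hk1 hjn] at hne
  tauto

/-- The mixed inner rows. [folklore] -/
def Mrows : Finset (Fin n) := Finset.univ.filter fun i : Fin n => Inner n i ∧ MixedRow A i

/-- A row is mixed for `Aᶜ` iff it is mixed for `A`. [folklore] -/
theorem mixedRow_compl {i : ℕ} (hi : i < n) : MixedRow Aᶜ i ↔ MixedRow A i := by
  unfold MixedRow
  constructor
  · rintro ⟨j, h1, h2, h3⟩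
    refine ⟨j, h1, h2, fun h => h3 ?_⟩
    rw [memN_iff hi (by omega), memN_iff hi (by omega), Finset.mem_compl, Finset.mem_compl]
    rw [memN_iff hi (by omega), memN_iff hi (by omega)] at h
    exact not_congr h
  · rintro ⟨j, h1, h2, h3⟩
    refine ⟨j, h1, h2, fun h => h3 ?_⟩
    rw [memN_iff hi (by omega), memN_iff hi (by omega)]
    rw [memN_iff hi (by omega), memN_iff hi (by omega), Finset.mem_compl, Finset.mem_compl] at h
    exact not_iff_not.1 h

/-- **Many far-apart mixed gadgets from a balanced set** (Valiant 1980, Lemmas 6–7, for the rhombus).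
[folklore] -/
theorem exists_gadgets (h8 : 8 ≤ n) (hA1 : n * n < 3 * A.card) (hA2 : 3 * A.card ≤ 2 * (n * n)) :
    ∃ G : List Gad, n ≤ 24 * G.length + 60 ∧ (∀ g ∈ G, Valid n g.1 g.2) ∧ G.Pairwise Far ∧
      ∀ g ∈ G, MixedGad hn A g := by
  by_cases hcase : 3 * (Mrows A).card + 37 ≤ n
  · -- CASE (c): few mixed rows ⇒ an inner-full row `i_f` and an inner-empty row `i_e`
    obtain ⟨i_f, hfin, -, hfull⟩ := exists_full_row A (Mrows A)
      (fun i hin hm => Finset.mem_filter.2 ⟨Finset.mem_univ _, hin, hm⟩) hcase hA1.le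
    have hcompl : n * n ≤ 3 * Aᶜ.card := by
      rw [Finset.card_compl, Fintype.card_prod, Fintype.card_fin]
      omega
    obtain ⟨i_e, hein, -, hemp⟩ := exists_full_row Aᶜ (Mrows A)
      (fun i hin hm => Finset.mem_filter.2 ⟨Finset.mem_univ _, hin, (mixedRow_compl A i.2).1 hm⟩) hcase hcompl
    have hemp' : ∀ j, Inner n j → ¬ memN A i_e j := by
      intro j hj hmem
      obtain ⟨h1, h2, h3⟩ := hemp j hj
      rw [Finset.mem_compl] at h3
      exact h3 ((memN_iff h1 h2).1 hmem)
    -- for every inner column a vertical mixed edge between the two rows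
    have hcol : ∀ j, Inner n j → ∃ k, 3 ≤ k ∧ k + 5 ≤ n ∧ ¬ (memN A k j ↔ memN A (k + 1) j) := by
      intro j hj
      have hPf : memN A i_f j := hfull j hj
      have hPe : ¬ memN A i_e j := hemp' j hj
      rcases lt_or_gt_of_ne (show (i_f : ℕ) ≠ i_e from fun h => hPe (h ▸ hPf)) with hlt | hlt
      · obtain ⟨k, h1, h2, h3, h4⟩ := exists_step (fun k => memN A k j) hlt.le hPf hPe
        refine ⟨k, ?_, ?_, fun h => h4 (h.1 h3)⟩
        · have := hfin.1; omega
        · have := hein.2; omega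
      · obtain ⟨k, h1, h2, h3, h4⟩ := exists_step (fun k => ¬ memN A k j) hlt.le hPe (not_not.2 hPf)
        refine ⟨k, ?_, ?_, fun h => h4 (fun h5 => h3 (h.2 h5))⟩
        · have := hein.1; omega
        · have := hfin.2; omega
    choose! kOf hkOf using hcol
    -- inner columns in the best residue class
    set C : Finset ℕ := (Finset.Ico 3 (n - 3)).filter fun j => True with hC
    obtain ⟨r, hr, hclass⟩ := exists_mod_class (Finset.Ico 3 (n - 3)) id
    set R : Finset ℕ := (Finset.Ico 3 (n - 3)).filter fun j => id j % 8 = r with hR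
    have hRinner : ∀ j ∈ R, Inner n j := by
      intro j hj
      rw [hR, Finset.mem_filter, Finset.mem_Ico] at hj
      exact ⟨hj.1.1, by omega⟩
    refine ⟨R.toList.map fun j => (false, ((kOf j : ℤ), (j : ℤ))), ?_, ?_, ?_, ?_⟩
    · rw [List.length_map, Finset.length_toList]
      have : (Finset.Ico 3 (n - 3)).card = n - 6 := by simp; omega
      rw [this] at hclass
      omega
    · intro g hg
      rw [List.mem_map] at hg
      obtain ⟨j, hj, rfl⟩ := hg
      rw [Finset.mem_toList] at hj
      obtain ⟨h1, h2, h3⟩ := hkOf j (hRinner j hj)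
      exact (gadget_of_vertical hn A h1 h2 (hRinner j hj) h3).1
    · rw [List.pairwise_map]
      apply List.Pairwise.imp_of_mem (R := fun a b => a ≠ b)
      · intro j j' hj hj' hne
        rw [Finset.mem_toList] at hj hj'
        right
        simp only
        have hm : j % 8 = j' % 8 := by
          rw [hR, Finset.mem_filter] at hj hj'
          simp only [id] at hj hj'
          rw [hj.2, hj'.2]
        exact eight_le_abs_sub hne hm
      · exact (Finset.nodup_toList R).pairwise_of_forall_ne (fun a _ b _ hab => hab)
    · intro g hg
      rw [List.mem_map] at hg
      obtain ⟨j, hj, rfl⟩ := hg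
      rw [Finset.mem_toList] at hj
      obtain ⟨h1, h2, h3⟩ := hkOf j (hRinner j hj)
      exact (gadget_of_vertical hn A h1 h2 (hRinner j hj) h3).2
  · -- CASE (b): many mixed rows
    push Not at hcase
    have hrows : ∀ i ∈ Mrows A, ∃ j : ℕ, Valid n true (((i : ℕ) : ℤ), (j : ℤ)) ∧
        MixedGad hn A (true, (((i : ℕ) : ℤ), (j : ℤ))) := by
      intro i hi
      rw [Mrows, Finset.mem_filter] at hi
      exact gadget_of_mixedRow hn A hi.2.1 hi.2.2
    choose! jOf hjOf using hrows
    obtain ⟨r, hr, hclass⟩ := exists_mod_class (Mrows A) (fun i => (i : ℕ))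
    set R : Finset (Fin n) := (Mrows A).filter fun i => (i : ℕ) % 8 = r with hR
    refine ⟨R.toList.map fun i : Fin n => (true, ((i.val : ℤ), ((jOf i : ℕ) : ℤ))), ?_, ?_, ?_, ?_⟩
    · rw [List.length_map, Finset.length_toList]
      omega
    · intro g hg
      rw [List.mem_map] at hg
      obtain ⟨i, hi, rfl⟩ := hg
      rw [Finset.mem_toList, hR, Finset.mem_filter] at hi
      exact (hjOf i hi.1).1
    · rw [List.pairwise_map]
      apply List.Pairwise.imp_of_mem (R := fun a b => a ≠ b)
      · intro i i' hi hi' hne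
        rw [Finset.mem_toList, hR, Finset.mem_filter] at hi hi'
        left
        simp only
        exact eight_le_abs_sub (fun h => hne (Fin.ext h)) (by rw [hi.2, hi'.2])
      · exact (Finset.nodup_toList R).pairwise_of_forall_ne (fun a _ b _ hab => hab)
    · intro g hg
      rw [List.mem_map] at hg
      obtain ⟨i, hi, rfl⟩ := hg
      rw [Finset.mem_toList, hR, Finset.mem_filter] at hi
      exact (hjOf i hi.1).2

end Select

end

end Summit.ValiantsHypothesis.ValiantsHypothesis.Theorems.TriangularDimersDivisionEasy.Negative
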